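/- Width seat 2/3 `ym-line-cbag-p1-w2` (prover-ym-line-cbag-p1-w2-g21-0) of the cell of ideator ym-idea-2, LINE 8
(route `EguchiKawaiDirectionLadder`), post-closure glue for the barrier entry `EguchiKawaiBreakdown` (crux
stmt-QuantumFields-27724, CLOSED·proved): in `d = 2` EVERY open Wilson word of the Eguchi–Kawai single-site model vanishes at
EVERY coupling.  Route-independent.  HONEST FRAMING: a theorem about the single-site integral in two dimensions; the reduction
`W_lattice = W_EK`, the `N = ∞` loop equations and the Yang–Mills mass gap / the summit `YangMills` are NOT proved or advanced. -/
import Summits.QuantumFields.YangMills.Theorems.EguchiKawaiDirectionLadderWilsonWordsTwoDimTorus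
import Summits.QuantumFields.YangMills.Theorems.EguchiKawaiDirectionLadderTwoDimSymmetric
import HarnessLib

/-!
# In `d = 2` all open Wilson words of the Eguchi–Kawai model vanish, at every coupling

Makeenko (*Methods of Contemporary Gauge Theory*, §14.4, PDF p. 250): the naive Eguchi–Kawai reduction "is valid, strictly
speaking, only in `d = 2`".  What the reduction needs is (14.51): the averages of ALL open reduced contours vanish at `N = ∞`.
The tree had this in `d = 2` for the ELEMENTARY lines only (`ekOrderParameter_two_le`, `⟨|(1/N) tr U_μ|²⟩ ≤ 1/N`); here it is
proved for every word:

* `ekExpectation_normSq_ekWord_two_le` — for `d = 2`, every `b ∈ ℝ`, `N ≥ 1`, every letter list `l` and direction `μ` with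
  non-zero winding `wordCharge l μ ≠ 0`:  `⟨|W_l|²⟩_EK ≤ 2 · (wordMult l μ)² / N`;
* `ekOpenWordsVanish_two` — hence `⟨|W_l|²⟩_EK → 0` as `N → ∞` for every open word at EVERY coupling (also `SU(N)`,
  `ekExpectationSU_normSq_ekWord_two_le`).

## Proof

Write the links as `(A, V)` and let the winding in the `V`-direction be `q ≠ 0` (the other case by relabelling).  By Fubini it
suffices to bound, for FIXED `A`, `∫ w_A(V) |tr W(A,V)|² dV ≤ 2N·m² ∫ w_A` (`m = wordMult`).  Diagonalise `A = P Λ P⁻¹`; the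
conjugate torus `D_z = P·diag(z)·P⁻¹` (`z : Fin N → S¹`) commutes with `A`, so `w_A(D_z V) = w_A(V)` (each plaquette word
carries `V, V⁻¹` once each), and Haar left invariance gives `∫ w_A |tr W(A,V)|² = ∫ w_A(V) · avg_z |tr W(A, D_z V)|²` for the
average over the finite torus `z ∈ μ_M^N` (`M = |q| + 1 ∤ q`, phases `ZMod.toCircle`).  The function `F(z) = tr W(A, D_z V)`
on `(ZMod M)^N` has
* MEAN ZERO: the global rotation `z ↦ ω z` multiplies `F` by `ω^q ≠ 1` (phase covariance (14.48), `ekWordMatrix_phase`);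
* RANK-ONE LIPSCHITZ dependence on each coordinate: changing `z_c` changes `D_z` by `(z'_c − z_c)·P E_cc P⁻¹`, and for unitary
  `Y, Z` one has `|tr(Y · P E_cc P⁻¹ · Z)| = |(P⁻¹ Z Y P)_cc| ≤ 1`; telescoping over the `m` occurrences of `V^{±1}` in the word
  (in TEST FORM, `norm_trace_mul_ekWordMatrix_sub_mul_le`) gives `|F(z') − F(z)| ≤ m |z'_c − z_c|`;
so the Efron–Stein inequality on the finite product (`FiniteAveraging.sum_norm_sq_le_of_sum_eq_zero`) yields
`avg |F|² ≤ M⁻¹ Σ_c avg_z Σ_a |F(z[c↦a]) − F(z)|² ≤ M⁻¹ · N · m² · 2M = 2N m²`.  (The sign flips of `TwoDimSymmetric` only see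
the winding mod `2`; the full finite torus sees every `q ≠ 0`.)  The finite-torus part (`sum_normSq_wordTrace_le`) is the
companion file `EguchiKawaiDirectionLadderWilsonWordsTwoDimTorus.lean`; this file does the Haar-invariance transfer, Fubini
over the first link, the direction relabelling and the headline statements.

References: Y. Makeenko, *Methods of Contemporary Gauge Theory* (CUP 2023) §14.3 (14.44)–(14.51), §14.4 (PDF pp. 245–250);
B. Efron, C. Stein, Ann. Statist. 9 (1981) 586–596.
-/

set_option autoImplicit false

noncomputable section

open scoped Matrix ComplexConjugate BigOperators RealInnerProductSpace
open Matrix Complex MeasureTheory Filter Topology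
open Literature.Barriers.QuantumFields
open Literature.LinearAlgebra.Matrix (diagonalTorus mem_diagonalTorus_iff exists_conj_mem_diagonalTorus
  mul_comm_of_mem_diagonalTorus diagonalTorusHom coe_diagonalTorusHom_apply)

namespace Summit.QuantumFields.YangMills.Theorems.EguchiKawaiDirectionLadder

variable {d N : ℕ}

/-! ### §4  Transfer to the one-link Haar integral at fixed first link -/

/-- The rotated-pair word trace depends continuously on the second link. -/
theorem continuous_wordTrace_pair (A T : UN N) (l : List (Fin 2 × Bool)) :
    Continuous fun V : UN N => (ekWordMatrix l (![A, T * V] : EKConfig 2 N)).trace :=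
  ((continuous_ekWordMatrix l).comp ((TwoDim.continuous_pair A).comp (continuous_const.mul continuous_id))).matrix_trace

/-- **The one-link inequality at fixed first link**: for every `A ∈ U(N)`, `b ∈ ℝ` and every word with non-zero winding
in the second direction, `∫ e^{−N²bS_R[A,V]} |tr W(A,V)|² dV ≤ 2N (wordMult l 1)² ∫ e^{−N²bS_R[A,V]} dV`. -/
theorem integral_ekWeight_pair_mul_normSq_wordTrace_le (b : ℝ) (A : UN N) {l : List (Fin 2 × Bool)}
    (hq : wordCharge l 1 ≠ 0) :
    ∫ V, ekWeight N b (![A, V] : EKConfig 2 N) * ‖(ekWordMatrix l (![A, V] : EKConfig 2 N)).trace‖ ^ 2 ∂haarUN N ≤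
      (2 * N * (wordMult l 1 : ℝ) ^ 2) * ∫ V, ekWeight N b (![A, V] : EKConfig 2 N) ∂haarUN N := by
  obtain ⟨P, hP⟩ := exists_conj_mem_diagonalTorus A
  -- the modulus of the finite torus: `M = |q| + 1 ∤ q`, `M ≥ 2`
  obtain ⟨M, hM2, hMq⟩ : ∃ M : ℕ, 2 ≤ M ∧ ¬ ((M : ℤ) ∣ wordCharge l 1) := by
    refine ⟨(wordCharge l 1).natAbs + 1, ?_, ?_⟩
    · have : (wordCharge l 1).natAbs ≠ 0 := Int.natAbs_ne_zero.2 hq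
      omega
    · intro hdvd
      refine hq (Int.eq_zero_of_dvd_of_natAbs_lt_natAbs hdvd ?_)
      rw [Int.natAbs_natCast]
      exact Nat.lt_succ_self _
  haveI : NeZero M := ⟨by omega⟩
  set w : UN N → ℝ := fun V => ekWeight N b (![A, V] : EKConfig 2 N) with hw
  set T : (Fin N → ZMod M) → UN N := fun m => P * diagonalTorusHom (Fin N) (fun i => ZMod.toCircle (m i)) * P⁻¹
    with hT
  set G : (Fin N → ZMod M) → UN N → ℝ := fun m V =>
    w V * ‖(ekWordMatrix l (![A, T m * V] : EKConfig 2 N)).trace‖ ^ 2 with hG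
  have hwc : Continuous w := TwoDim.continuous_ekWeight_pair b A
  have hGc : ∀ m, Continuous (G m) := fun m => hwc.mul ((continuous_wordTrace_pair A (T m) l).norm.pow 2)
  -- (1) invariance: the integral equals the integral of the rotated word, for every `m`
  have hinv : ∀ m, ∫ V, w V * ‖(ekWordMatrix l (![A, V] : EKConfig 2 N)).trace‖ ^ 2 ∂haarUN N =
      ∫ V, G m V ∂haarUN N := by
    intro m
    have hmp : MeasurePreserving (fun V : UN N => T m * V) (haarUN N) (haarUN N) := measurePreserving_mul_left _ _
    have hemb : MeasurableEmbedding (fun V : UN N => T m * V) := (MeasurableEquiv.mulLeft (T m)).measurableEmbedding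
    have hcomm : T m * A = A * T m := conj_torus_mul_comm hP _
    calc ∫ V, w V * ‖(ekWordMatrix l (![A, V] : EKConfig 2 N)).trace‖ ^ 2 ∂haarUN N
        = ∫ V, w (T m * V) * ‖(ekWordMatrix l (![A, T m * V] : EKConfig 2 N)).trace‖ ^ 2 ∂haarUN N := by
          rw [← hmp.integral_comp hemb]
      _ = ∫ V, G m V ∂haarUN N := by
          refine integral_congr_ae (Eventually.of_forall fun V => ?_)
          simp only [hG, hw, TwoDim.ekWeight_pair_mul_left b A V (T m) hcomm]
  -- (2) sum over the finite torus and use the pointwise bound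
  have hcard : (0 : ℝ) < Fintype.card (Fin N → ZMod M) := Nat.cast_pos.2 Fintype.card_pos
  have hsum : (Fintype.card (Fin N → ZMod M) : ℝ) *
      ∫ V, w V * ‖(ekWordMatrix l (![A, V] : EKConfig 2 N)).trace‖ ^ 2 ∂haarUN N =
        ∫ V, ∑ m, G m V ∂haarUN N := by
    rw [integral_finsetSum _ (fun m _ => integrable_of_continuous (hGc m))]
    simp_rw [← hinv]
    rw [Finset.sum_const, Finset.card_univ, nsmul_eq_mul]
  have hpt : ∀ V, ∑ m, G m V ≤ w V * (2 * N * (wordMult l 1 : ℝ) ^ 2 * Fintype.card (Fin N → ZMod M)) := by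
    intro V
    simp only [hG]
    rw [← Finset.mul_sum]
    exact mul_le_mul_of_nonneg_left (sum_normSq_wordTrace_le hM2 P A V hMq) (Real.exp_pos _).le
  have hle : ∫ V, ∑ m, G m V ∂haarUN N ≤
      ∫ V, w V * (2 * N * (wordMult l 1 : ℝ) ^ 2 * Fintype.card (Fin N → ZMod M)) ∂haarUN N :=
    integral_mono (integrable_finsetSum _ (fun m _ => integrable_of_continuous (hGc m)))
      ((integrable_of_continuous hwc).mul_const _) hpt
  rw [integral_mul_const] at hle
  -- (3) divide by the cardinality of the torus
  have key : (Fintype.card (Fin N → ZMod M) : ℝ) *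
      ∫ V, w V * ‖(ekWordMatrix l (![A, V] : EKConfig 2 N)).trace‖ ^ 2 ∂haarUN N ≤
        (Fintype.card (Fin N → ZMod M) : ℝ) * ((2 * N * (wordMult l 1 : ℝ) ^ 2) * ∫ V, w V ∂haarUN N) := by
    rw [hsum]
    refine hle.trans (le_of_eq ?_)
    ring
  exact le_of_mul_le_mul_left key hcard

/-! ### §5  Fubini over the first link; the headline statements -/

/-- The pointwise (first-link) inequality for the normalised word: for every `A`,
`∫ |W_l(A,V)|² e^{−N²bS_R[A,V]} dV ≤ (2 (wordMult l 1)²/N) ∫ e^{−N²bS_R[A,V]} dV`. -/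
theorem integral_pair_normSq_ekWord_le (hN : 0 < N) (b : ℝ) (A : UN N) {l : List (Fin 2 × Bool)}
    (hq : wordCharge l 1 ≠ 0) :
    ∫ V, ‖ekWord l (![A, V] : EKConfig 2 N)‖ ^ 2 * ekWeight N b (![A, V] : EKConfig 2 N) ∂haarUN N ≤
      (2 * (wordMult l 1 : ℝ) ^ 2 / N) * ∫ V, ekWeight N b (![A, V] : EKConfig 2 N) ∂haarUN N := by
  have hN' : (0 : ℝ) < N := Nat.cast_pos.2 hN
  have hsq : ∀ V : UN N, ‖ekWord l (![A, V] : EKConfig 2 N)‖ ^ 2 * ekWeight N b (![A, V] : EKConfig 2 N) =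
      (1 / (N : ℝ) ^ 2) * (ekWeight N b (![A, V] : EKConfig 2 N) *
        ‖(ekWordMatrix l (![A, V] : EKConfig 2 N)).trace‖ ^ 2) := by
    intro V
    rw [ekWord, norm_div, Complex.norm_natCast, div_pow]
    ring
  simp_rw [hsq]
  rw [integral_const_mul]
  calc 1 / (N : ℝ) ^ 2 * ∫ V, ekWeight N b (![A, V] : EKConfig 2 N) *
          ‖(ekWordMatrix l (![A, V] : EKConfig 2 N)).trace‖ ^ 2 ∂haarUN N
      ≤ 1 / (N : ℝ) ^ 2 * ((2 * N * (wordMult l 1 : ℝ) ^ 2) * ∫ V, ekWeight N b (![A, V] : EKConfig 2 N) ∂haarUN N) :=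
        mul_le_mul_of_nonneg_left (integral_ekWeight_pair_mul_normSq_wordTrace_le b A hq) (by positivity)
    _ = (2 * (wordMult l 1 : ℝ) ^ 2 / N) * ∫ V, ekWeight N b (![A, V] : EKConfig 2 N) ∂haarUN N := by
        rw [← mul_assoc]
        congr 1
        field_simp

/-- **Numerator `≤ (2m²/N) ·` denominator** for the second moment of a word with non-zero winding in direction `1`. -/
theorem integral_normSq_ekWord_mul_ekWeight_two_le (hN : 0 < N) (b : ℝ) {l : List (Fin 2 × Bool)}
    (hq : wordCharge l 1 ≠ 0) :
    ∫ U, ‖ekWord l U‖ ^ 2 * ekWeight N b U ∂ekHaar 2 N ≤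
      (2 * (wordMult l 1 : ℝ) ^ 2 / N) * ∫ U, ekWeight N b U ∂ekHaar 2 N := by
  have hc₁ : Continuous fun U : EKConfig 2 N => ‖ekWord l U‖ ^ 2 * ekWeight N b U :=
    ((continuous_ekWord (d := 2) (N := N) l).norm.pow 2).mul (continuous_ekWeight (d := 2) N b)
  have hc₂ : Continuous fun U : EKConfig 2 N => ekWeight N b U := continuous_ekWeight (d := 2) N b
  have h1 := TwoDim.integral_ekHaar_two (fun U : EKConfig 2 N => ‖ekWord l U‖ ^ 2 * ekWeight N b U) hc₁
  have h2 := TwoDim.integral_ekHaar_two (fun U : EKConfig 2 N => ekWeight N b U) hc₂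
  have hf := TwoDim.integrable_integral_pair (fun U : EKConfig 2 N => ‖ekWord l U‖ ^ 2 * ekWeight N b U) hc₁
  have hg := (TwoDim.integrable_integral_pair (fun U : EKConfig 2 N => ekWeight N b U) hc₂).const_mul
    (2 * (wordMult l 1 : ℝ) ^ 2 / N)
  have hfg := integral_mono hf hg fun A => integral_pair_normSq_ekWord_le hN b A hq
  have h3 := integral_const_mul (μ := haarUN N) (2 * (wordMult l 1 : ℝ) ^ 2 / N)
    (fun A : UN N => ∫ V, ekWeight N b (![A, V] : EKConfig 2 N) ∂haarUN N)
  calc ∫ U, ‖ekWord l U‖ ^ 2 * ekWeight N b U ∂ekHaar 2 N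
      = ∫ A, (∫ V, ‖ekWord l (![A, V] : EKConfig 2 N)‖ ^ 2 * ekWeight N b (![A, V] : EKConfig 2 N) ∂haarUN N)
          ∂haarUN N := h1
    _ ≤ ∫ A, (2 * (wordMult l 1 : ℝ) ^ 2 / N) * (∫ V, ekWeight N b (![A, V] : EKConfig 2 N) ∂haarUN N) ∂haarUN N := hfg
    _ = (2 * (wordMult l 1 : ℝ) ^ 2 / N) * ∫ A, (∫ V, ekWeight N b (![A, V] : EKConfig 2 N) ∂haarUN N) ∂haarUN N := h3
    _ = (2 * (wordMult l 1 : ℝ) ^ 2 / N) * ∫ U, ekWeight N b U ∂ekHaar 2 N :=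
        congrArg (fun z : ℝ => (2 * (wordMult l 1 : ℝ) ^ 2 / N) * z) h2.symm

/-- The bound in direction `1`: `⟨|W_l|²⟩_EK ≤ 2 (wordMult l 1)²/N`. -/
theorem ekExpectation_normSq_ekWord_two_le_one (hN : 0 < N) (b : ℝ) {l : List (Fin 2 × Bool)}
    (hq : wordCharge l 1 ≠ 0) :
    ekExpectation N b (fun U : EKConfig 2 N => ‖ekWord l U‖ ^ 2) ≤ 2 * (wordMult l 1 : ℝ) ^ 2 / N := by
  unfold ekExpectation
  rw [div_le_iff₀ (ekPartition_pos 2 N b)]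
  exact integral_normSq_ekWord_mul_ekWeight_two_le hN b hq

/-! ### Relabelling the two directions -/

/-- Words of the relabelled configuration are relabelled words: `W_l(U ∘ σ) = W_{σ·l}(U)`. -/
theorem ekWordMatrix_relabel (σ : Equiv.Perm (Fin d)) (l : List (Fin d × Bool)) (U : EKConfig d N) :
    ekWordMatrix l (relabel σ U) = ekWordMatrix (l.map fun a => (σ a.1, a.2)) U := by
  induction l with
  | nil => simp
  | cons a l ih =>
      rw [List.map_cons, ekWordMatrix_cons, ekWordMatrix_cons, ih]
      rfl

/-- The same for the normalised word. -/
theorem ekWord_relabel (σ : Equiv.Perm (Fin d)) (l : List (Fin d × Bool)) (U : EKConfig d N) :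
    ekWord l (relabel σ U) = ekWord (l.map fun a => (σ a.1, a.2)) U := by
  rw [ekWord, ekWord, ekWordMatrix_relabel]

/-- Letter counts of the relabelled word. -/
theorem wordPlus_map_relabel (σ : Equiv.Perm (Fin d)) (l : List (Fin d × Bool)) (μ : Fin d) :
    wordPlus (l.map fun a => (σ a.1, a.2)) (σ μ) = wordPlus l μ := by
  unfold wordPlus
  rw [List.countP_map]
  congr 1
  funext a
  obtain ⟨ν, ε⟩ := a
  simp [Prod.ext_iff]

/-- Letter counts of the relabelled word. -/
theorem wordMinus_map_relabel (σ : Equiv.Perm (Fin d)) (l : List (Fin d × Bool)) (μ : Fin d) :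
    wordMinus (l.map fun a => (σ a.1, a.2)) (σ μ) = wordMinus l μ := by
  unfold wordMinus
  rw [List.countP_map]
  congr 1
  funext a
  obtain ⟨ν, ε⟩ := a
  simp [Prod.ext_iff]

/-- Multiplicities of the relabelled word. -/
theorem wordMult_map_relabel (σ : Equiv.Perm (Fin d)) (l : List (Fin d × Bool)) (μ : Fin d) :
    wordMult (l.map fun a => (σ a.1, a.2)) (σ μ) = wordMult l μ := by
  unfold wordMult
  rw [List.countP_map]
  congr 1
  funext a
  obtain ⟨ν, ε⟩ := a
  simp

/-- Windings of the relabelled word. -/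
theorem wordCharge_map_relabel (σ : Equiv.Perm (Fin d)) (l : List (Fin d × Bool)) (μ : Fin d) :
    wordCharge (l.map fun a => (σ a.1, a.2)) (σ μ) = wordCharge l μ := by
  rw [wordCharge, wordCharge, wordPlus_map_relabel, wordMinus_map_relabel]

/-- **Direction symmetry of the second moments of words**: `⟨|W_l|²⟩ = ⟨|W_{σ·l}|²⟩` (relabelling the directions preserves
the measure and the weight). -/
theorem ekExpectation_normSq_ekWord_relabel (b : ℝ) (σ : Equiv.Perm (Fin d)) (l : List (Fin d × Bool)) :
    ekExpectation N b (fun U : EKConfig d N => ‖ekWord l U‖ ^ 2) =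
      ekExpectation N b (fun U : EKConfig d N => ‖ekWord (l.map fun a => (σ a.1, a.2)) U‖ ^ 2) := by
  unfold ekExpectation
  congr 1
  have hmp := measurePreserving_relabelEquiv (N := N) σ
  rw [← hmp.integral_comp' (fun U : EKConfig d N => ‖ekWord l U‖ ^ 2 * ekWeight N b U)]
  refine integral_congr_ae (Eventually.of_forall fun U => ?_)
  simp only [coe_relabelEquiv, ekWeight_relabel, ekWord_relabel]

/-! ### The theorems -/

/-- **In `d = 2` every open Wilson word has second moment `O(1/N)` at EVERY coupling**: for `b ∈ ℝ`, `N ≥ 1`, a letter list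
`l` and a direction `μ` with non-zero winding `wordCharge l μ ≠ 0`,
`⟨|(1/N) tr ∏ⱼ U_{μⱼ}^{εⱼ}|²⟩_EK ≤ 2 (wordMult l μ)² / N`.  (For the one-letter word this is `ekOrderParameter_two_le` up to
the constant.)  Makeenko §14.4: the naive reduction is valid in `d = 2` — here for all reduced contours, quantitatively. -/
theorem ekExpectation_normSq_ekWord_two_le (hN : 0 < N) (b : ℝ) {l : List (Fin 2 × Bool)} {μ : Fin 2}
    (hq : wordCharge l μ ≠ 0) :
    ekExpectation N b (fun U : EKConfig 2 N => ‖ekWord l U‖ ^ 2) ≤ 2 * (wordMult l μ : ℝ) ^ 2 / N := by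
  rcases Fin.eq_zero_or_eq_succ μ with rfl | ⟨j, rfl⟩
  · -- direction `0`: relabel by the transposition `(0 1)`
    set σ : Equiv.Perm (Fin 2) := Equiv.swap 0 1 with hσ
    have hσ0 : σ 0 = 1 := by rw [hσ, Equiv.swap_apply_left]
    rw [ekExpectation_normSq_ekWord_relabel b σ l]
    have hq' : wordCharge (l.map fun a => (σ a.1, a.2)) 1 ≠ 0 := by rwa [← hσ0, wordCharge_map_relabel]
    have hm : wordMult (l.map fun a => (σ a.1, a.2)) 1 = wordMult l 0 := by rw [← hσ0, wordMult_map_relabel]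
    have h := ekExpectation_normSq_ekWord_two_le_one hN b hq'
    rwa [hm] at h
  · have hj : j = 0 := Fin.eq_zero j
    subst hj
    exact ekExpectation_normSq_ekWord_two_le_one hN b hq

/-- The second moment of a word is non-negative. -/
theorem ekExpectation_normSq_ekWord_nonneg (b : ℝ) (l : List (Fin d × Bool)) :
    0 ≤ ekExpectation N b (fun U : EKConfig d N => ‖ekWord l U‖ ^ 2) := by
  unfold ekExpectation
  refine div_nonneg (integral_nonneg fun U => ?_) (ekPartition_pos d N b).le
  exact mul_nonneg (by positivity) (Real.exp_pos _).le

/-- **All open Wilson words vanish in `d = 2` at every coupling** ((14.51) for every open reduced contour `C_xy`, not only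
the elementary lines of `ekOpenLinesVanish_two`): for `b ∈ ℝ` and a word with non-zero winding in some direction,
`⟨|W_l|²⟩_EK → 0` as `N → ∞`. -/
theorem ekOpenWordsVanish_two (b : ℝ) {l : List (Fin 2 × Bool)} {μ : Fin 2} (hq : wordCharge l μ ≠ 0) :
    Tendsto (fun N : ℕ => ekExpectation N b (fun U : EKConfig 2 N => ‖ekWord l U‖ ^ 2)) atTop (𝓝 0) := by
  have hlim : Tendsto (fun N : ℕ => 2 * (wordMult l μ : ℝ) ^ 2 / N) atTop (𝓝 0) :=
    tendsto_const_nhds.div_atTop tendsto_natCast_atTop_atTop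
  refine tendsto_of_tendsto_of_tendsto_of_le_of_le' tendsto_const_nhds hlim ?_ ?_
  · exact Eventually.of_forall fun N => ekExpectation_normSq_ekWord_nonneg b l
  · filter_upwards [eventually_gt_atTop 0] with N hN
    exact ekExpectation_normSq_ekWord_two_le hN b hq

/-- The same bound for the gauge group `SU(N)` (`|W_l|²` is phase invariant, `ekExpectation_normSq_ekWord_eq`). -/
theorem ekExpectationSU_normSq_ekWord_two_le (hN : 0 < N) (b : ℝ) {l : List (Fin 2 × Bool)} {μ : Fin 2}
    (hq : wordCharge l μ ≠ 0) :
    ekExpectationSU N b (fun V : EKConfigSU 2 N => ‖ekWord l (inclSU V)‖ ^ 2) ≤ 2 * (wordMult l μ : ℝ) ^ 2 / N := by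
  rw [← ekExpectation_normSq_ekWord_eq]
  exact ekExpectation_normSq_ekWord_two_le hN b hq

/-- **All open Wilson words of the `SU(N)` single-site model vanish in `d = 2` at every coupling.** -/
theorem ekOpenWordsVanishSU_two (b : ℝ) {l : List (Fin 2 × Bool)} {μ : Fin 2} (hq : wordCharge l μ ≠ 0) :
    Tendsto (fun N : ℕ => ekExpectationSU N b (fun V : EKConfigSU 2 N => ‖ekWord l (inclSU V)‖ ^ 2)) atTop (𝓝 0) := by
  have h := ekOpenWordsVanish_two b hq
  refine h.congr fun N => ?_
  exact ekExpectation_normSq_ekWord_eq b l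

end Summit.QuantumFields.YangMills.Theorems.EguchiKawaiDirectionLadder

end
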